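import Literature.MathematicalPhysics.QuantumFieldTheory.Federbush1986.NonAbelianDualityEdgeSizes
import Literature.MathematicalPhysics.QuantumFieldTheory.Federbush1986.NonAbelianDualityPlaquetteBCH

/-!
# `Federbush1986.NonAbelianDualityPlaquetteAction` — [Federbush1987PhaseCellVI] THEOREM 2 p. 20, ingredient: the
# PER-PLAQUETTE EXPANSION of the associated lattice assignments, `| |g_∂p| − |∮_∂p A + ℓ_s²[A_μ, A_ν](x_p)| | ≤
# K·(B₁′ + B₂′)²·ℓ_s³` with `B₁′, B₂′` LOCAL bounds of the potential near the plaquette (theorems only)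

statement-level skeleton of published theorems with citation tags; proofs where landed; nothing here is a claim about the Yang–Mills mass gap

CITATION HEADER.  P. Federbush, *A phase cell approach to Yang–Mills theory. VI. Non-abelian lattice-continuum duality*,
Ann. Inst. H. Poincaré (Physique théorique) **47** (1987) 17–23, Numdam `AIHPA_1987__47_1_17_0` [Federbush1987PhaseCellVI]
(cell paper F6; pp. 18–23 READ AS IMAGES `run/shared/lean/pub/lit-balaban/lit-balaban-r19/renders/fedVI/fedVI-p003…p008.png`).
P. Federbush, *… I. Modes, lattice-continuum duality*, Commun. Math. Phys. **107** (1986) 319–329 [Federbush1986PhaseCellI].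
Unit `lit-balaban-r19` gen 5 (reader/typer r19; owner of the F6 statement file); SKELETON row **F6.Thm2** (statement of record
`BlockSpinSystem.Theorem2Oriented`, `NonAbelianDuality.lean` v5) — INGREDIENT (h) of its Phase-2 proof (plan HOME/INBOX r19 →
r17 2026-08-21).  Inputs BY NAME: `absG_plaqWord_expansion_affine` (`NonAbelianDualityPlaquetteBCH`, this unit),
`norm_plaqV_iterBlockSpinLog_sub_linear_le`, `norm_iterBlockSpinLog_logData_le_of_le` (`NonAbelianDualityPlaquetteCascade`,
this unit), `norm_iterBlockSpinLog_logData_sub_smul_le_of_le` (`NonAbelianDualityEdgeSizes`, this unit),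
`norm_plaq_linearCascade_logData_sub_le`, `plaqFunctionalV` (`LinearCascadePlaquette`, unit r17), `iterBlockSpin_exp`
(`NonAbelianDualityEq28Proof`, unit r17), `cutoff`, `gApprox_congr_of_eqOn` (`NonAbelianDualityLocality`, this unit gen 3),
`theorem1_of_chart_tendsto` (`NonAbelianDualityTheorem1`, unit r17).  HOME `run/shared/lean/pub/lit-balaban/`.

WHAT IS PRINTED.  VI p. 20: «S^r_0 = ¼ Σ_p |g_∂p|² (10)», Theorem 2 («for the compatible set of lattice assignments associated
to A_μ(x), the corresponding lattice actions, S^r_0, converge to the continuum action»), p. 18 «½∫(dA + A∧A)²»; p. 23 «We will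
not detail the proof of Theorem 2, but note that by the uniqueness, one may study lim_{r→∞} lim_{s→∞} S^r_0(A(·, s)) …».

THE MATHEMATICS (the per-plaquette step print leaves to the reader).  For a plaquette `p = (b; μ, ν)` of `ℒ^s`, `x_p = ℓ_s b`,
write the four edge variables of the level-`s` configuration `A′(·; s)[r]` of the cascade from level `r` as `a_i = ℓ_sU_i + δ_i`
with `U₁ = U₃ = A_μ(x_p)`, `U₂ = U₄ = A_ν(x_p)` and `|δ_i| ≤ Dℓ_s²`, `D = K_e(B₂′ + B₁′²) + 2B₂′` (`NonAbelianDualityEdgeSizes` +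
the shift of the source by one lattice unit).  The second-order BCH expansion (`absG_plaqWord_expansion_affine`) gives
`| |e^{a₁}e^{a₂}e^{−a₃}e^{−a₄}| − |a₁ + a₂ − a₃ − a₄ + ℓ_s²[U, W]| | ≤ E_bch ℓ_s³`, `E_bch = 64K(B₁′ + D)³ + L(6B₁′D + 3D²)`;
the linear combination `a₁ + a₂ − a₃ − a₄` is the plaquette value of the logarithmic cascade, within `K_cB₁′B₂′ℓ_s³` of that of
its linear part (`NonAbelianDualityPlaquetteCascade`), which is within `792B₂′ℓ_sℓ_r` of `∮_∂p A` (`plaqFunctionalV`, unit r17).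
Every error monomial has degree ≥ 2 in `(B₁′, B₂′)`, so the total is `≤ K(B₁′ + B₂′)²ℓ_s³ + 792B₂′ℓ_sℓ_r` with `K` depending
on the scheme and on the CAPS only (§3).  For the potential of Theorem 2 (globally bounded with its derivatives, being `C¹`
with decay) the assignments near `p` are those of the smooth cutoff `χ_pA` (`χ_p ≡ 1` on `closedBall x_p 9`), whose global
bounds are the local bounds of `A` on `closedBall x_p 10` (up to the fixed gradient of `χ`, §1); letting `r → ∞` through (12)
(`theorem1_of_chart_tendsto` + uniqueness) gives the expansion for the associated family itself (§4).

WHAT THIS MODULE PROVES (theorems only; no `def`, no `Prop` definition, no named fact; axioms standard).  §1 `bumpAt_apply_eq`,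
`exists_bound_fderiv_bumpAt`, **`cutoff_bounds_of_local`**; §2 **`gApprox_eq_exp_of_le`** (log coordinates of the approximates,
threshold from the cap); §3 **`absG_plaqHol_gApprox_expansion`**; §4 `injOn_exp_of_chart`, `plaqFunctionalV_congr_of_eqOn`,
`tendsto_plaqHol`, **`absG_plaqHol_assoc_expansion`** (the per-plaquette expansion of the associated family with LOCAL bounds).
-/

namespace Literature.MathematicalPhysics.QuantumFieldTheory.Federbush1986

noncomputable section

open Filter Metric Set MeasureTheory
open scoped Topology BigOperators

/-- `ℓ_j → 0`. [cite: Federbush1987PhaseCellVI, (26) p. 22] -/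
private theorem tendsto_latLen₇ : Tendsto latLen atTop (𝓝 0) := by
  unfold latLen; exact tendsto_inv_atTop_zero.comp (tendsto_pow_atTop_atTop_of_one_lt one_lt_two)

/-- The source of the edge at `b + e_i` is the source at `b` shifted by `ℓ_r e_i`. [cite: Federbush1986PhaseCellI, §1 p. 321] -/
private theorem src_add_single₇ {r : ℕ} (b : Fin 4 → ℤ) (i ν ν' : Fin 4) :
    (⟨b + Pi.single i 1, ν⟩ : Edge r).src = (⟨b, ν'⟩ : Edge r).src + latLen r • unitVec i := by
  simp only [Edge.src, mkPt, unitVec]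
  rw [show (EuclideanSpace.single i (1 : ℝ) : E4) = WithLp.toLp 2 (Pi.single i (1 : ℝ)) from rfl,
    ← WithLp.toLp_smul, ← WithLp.toLp_add]
  congr 1
  funext k
  rw [Pi.add_apply, Pi.add_apply, Pi.smul_apply, Pi.single_apply, Pi.single_apply]
  split_ifs <;> push_cast <;> ring

namespace BlockSpinSystem

variable (S : BlockSpinSystem)

/-! ## §1 The smooth cutoff with HOMOGENEOUS bounds -/

/-- The bump at `c` is the translate of the bump at `0`. [cite: Federbush1987PhaseCellVI, Theorem 1 p. 20] -/
theorem bumpAt_apply_eq (c : E4) (R : ℝ) (y : E4) : (bumpAt c R) y = (bumpAt 0 R) (y - c) := by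
  show (someContDiffBumpBase E4).toFun _ _ = (someContDiffBumpBase E4).toFun _ _
  simp only [sub_zero]
  rfl

/-- The gradient of the bump is bounded uniformly in the centre. [cite: Federbush1987PhaseCellVI, Theorem 1 p. 20] -/
theorem exists_bound_fderiv_bumpAt (R : ℝ) : ∃ κ : ℝ, 0 ≤ κ ∧ ∀ c y : E4, ‖fderiv ℝ (bumpAt c R) y‖ ≤ κ := by
  have hd : ContDiff ℝ 1 (bumpAt (0 : E4) R) := (bumpAt 0 R).contDiff
  have hs : HasCompactSupport (fderiv ℝ (bumpAt (0 : E4) R)) := (bumpAt 0 R).hasCompactSupport.fderiv (𝕜 := ℝ)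
  obtain ⟨C, hC⟩ := (hd.continuous_fderiv one_ne_zero).bounded_above_of_compact_support hs
  refine ⟨max C 0, le_max_right _ _, fun c y => ?_⟩
  have h : ((bumpAt c R : ContDiffBump c) : E4 → ℝ) = fun y => (bumpAt 0 R) (y - c) := funext (bumpAt_apply_eq c R)
  have h2 : fderiv ℝ (fun y => (bumpAt (0 : E4) R) (y - c)) y = fderiv ℝ (bumpAt (0 : E4) R) (y - c) := by
    simpa [sub_eq_add_neg] using fderiv_comp_add_right (f := ((bumpAt (0 : E4) R : ContDiffBump (0 : E4)) : E4 → ℝ)) (x := y) (-c)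
  rw [h, h2]
  exact (hC _).trans (le_max_left _ _)

/-- **The cutoff `χ_cA` (`χ_c ≡ 1` on `closedBall c 9`, supported in `closedBall c 10`) has global bounds given by the LOCAL
bounds of `A` on `closedBall c 10`**: `|χA| ≤ B₁′`, `|D(χA)| ≤ B₂′ + κB₁′`, `κ` a fixed number (the gradient bound of `χ`).
[cite: Federbush1987PhaseCellVI, Theorem 2 hypotheses p. 20, (28) p. 22] -/
theorem cutoff_bounds_of_local : ∃ κ : ℝ, 0 ≤ κ ∧ ∀ (c : E4) (A : S.Potential), ContDiff ℝ 1 A →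
    ∀ (B₁' B₂' : ℝ), 0 ≤ B₁' → 0 ≤ B₂' →
      (∀ y ∈ closedBall c 10, ∀ μ, ‖A y μ‖ ≤ B₁') →
      (∀ y ∈ closedBall c 10, ∀ μ ν, ‖fderiv ℝ (fun z => A z μ) y (unitVec ν)‖ ≤ B₂') →
        (∀ y μ, ‖S.cutoff c 9 A y μ‖ ≤ B₁') ∧
        ∀ y μ ν, ‖fderiv ℝ (fun z => S.cutoff c 9 A z μ) y (unitVec ν)‖ ≤ B₂' + κ * B₁' := by
  obtain ⟨κ, hκ, Hκ⟩ := exists_bound_fderiv_bumpAt 9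
  refine ⟨κ, hκ, fun c A hA B₁' B₂' hB₁' hB₂' hloc₁ hloc₂ => ?_⟩
  have hrOut : (bumpAt c 9).rOut = 10 := by show max (9 : ℝ) 1 + 1 = 10; norm_num
  have hts : tsupport (bumpAt c 9) = closedBall c 10 := by rw [ContDiffBump.tsupport_eq, hrOut]
  have hzero : ∀ y, y ∉ closedBall c 10 → (bumpAt c 9) y = 0 := fun y hy =>
    image_eq_zero_of_notMem_tsupport (by rwa [hts])
  have hfzero : ∀ y, y ∉ closedBall c 10 → fderiv ℝ (bumpAt c 9) y = 0 := fun y hy =>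
    fderiv_of_notMem_tsupport ℝ (by rwa [hts])
  have hle1 : ∀ y, |(bumpAt c 9) y| ≤ 1 := fun y => by
    rw [abs_of_nonneg ((bumpAt c 9).nonneg)]; exact (bumpAt c 9).le_one
  refine ⟨fun y μ => ?_, fun y μ ν => ?_⟩
  · show ‖(bumpAt c 9) y • A y μ‖ ≤ B₁'
    rw [norm_smul, Real.norm_eq_abs]
    by_cases hy : y ∈ closedBall c 10
    · calc |(bumpAt c 9) y| * ‖A y μ‖ ≤ 1 * B₁' := mul_le_mul (hle1 y) (hloc₁ y hy μ) (norm_nonneg _) zero_le_one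
        _ = B₁' := one_mul _
    · rw [hzero y hy, abs_zero, zero_mul]; exact hB₁'
  · have hAμ : DifferentiableAt ℝ (fun z => A z μ) y :=
      differentiableAt_pi.mp ((hA.differentiable (by simp)) y) μ
    have hχ : DifferentiableAt ℝ (bumpAt c 9) y :=
      ((bumpAt c 9).contDiff (n := 1)).differentiable (by simp) y
    have hderiv : HasFDerivAt (fun z => S.cutoff c 9 A z μ)
        ((bumpAt c 9) y • fderiv ℝ (fun z => A z μ) y + (fderiv ℝ (bumpAt c 9) y).smulRight (A y μ)) y :=
      hχ.hasFDerivAt.smul hAμ.hasFDerivAt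
    rw [hderiv.fderiv]
    show ‖(bumpAt c 9) y • fderiv ℝ (fun z => A z μ) y (unitVec ν) + fderiv ℝ (bumpAt c 9) y (unitVec ν) • A y μ‖ ≤ _
    have hu : ‖unitVec ν‖ = 1 := by simp [unitVec]
    by_cases hy : y ∈ closedBall c 10
    · calc ‖(bumpAt c 9) y • fderiv ℝ (fun z => A z μ) y (unitVec ν) + fderiv ℝ (bumpAt c 9) y (unitVec ν) • A y μ‖
          ≤ ‖(bumpAt c 9) y • fderiv ℝ (fun z => A z μ) y (unitVec ν)‖ + ‖fderiv ℝ (bumpAt c 9) y (unitVec ν) • A y μ‖ :=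
            norm_add_le _ _
        _ ≤ 1 * B₂' + κ * B₁' := by
            rw [norm_smul, norm_smul, Real.norm_eq_abs, Real.norm_eq_abs]
            refine add_le_add (mul_le_mul (hle1 y) (hloc₂ y hy μ ν) (norm_nonneg _) zero_le_one)
              (mul_le_mul ?_ (hloc₁ y hy μ) (norm_nonneg _) hκ)
            calc |fderiv ℝ (bumpAt c 9) y (unitVec ν)| = ‖fderiv ℝ (bumpAt c 9) y (unitVec ν)‖ := (Real.norm_eq_abs _).symm
              _ ≤ ‖fderiv ℝ (bumpAt c 9) y‖ * ‖unitVec ν‖ := ContinuousLinearMap.le_opNorm _ _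
              _ ≤ κ := by rw [hu, mul_one]; exact Hκ c y
        _ = B₂' + κ * B₁' := by ring
    · rw [hzero y hy, hfzero y hy]
      simpa using (by positivity : (0 : ℝ) ≤ B₂' + κ * B₁')

/-! ## §2 The approximates of a bounded potential in logarithmic coordinates, threshold from the cap -/

/-- **`g(e, n)(s) = exp(A′(e; s)[n])` past a threshold depending on the cap only**: (13)/(18) down the run, the fine variables
being `≤ K₁B₁′ℓ_j < ε_F` at every level (`norm_iterBlockSpinLog_logData_le_of_le`, `iterBlockSpin_exp`).
[cite: Federbush1987PhaseCellVI, (11) p. 20, (13), (18) p. 21, (26) p. 22] -/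
theorem gApprox_eq_exp_of_le (hFS : S.IsFederbushSystem) : ∀ B₁ : ℝ, 0 ≤ B₁ → ∃ s₄ : ℕ, ∀ (A' : S.Potential) (B₁' : ℝ),
    (∀ x μ, ‖A' x μ‖ ≤ B₁') → B₁' ≤ B₁ → ∀ (n s : ℕ), s₄ < s → s ≤ n → ∀ e : Edge s,
      S.gApprox A' n s e = S.exp (S.iterBlockSpinLog s n (S.logData A' n) e) := by
  intro B₁ hB₁
  obtain ⟨K₁, hK₁, HK⟩ := S.norm_iterBlockSpinLog_logData_le_of_le hFS
  obtain ⟨s₁, Hs⟩ := HK B₁ hB₁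
  have hK₁0 : 0 ≤ K₁ := by linarith
  obtain ⟨sε, Hε⟩ := exists_latLen_lt (show 0 < S.εF / (K₁ * B₁ + 1) by have := S.εF_pos; positivity)
  refine ⟨max s₁ sε, fun A' B₁' hB₁' hcap n s hs hsn e => ?_⟩
  have hB₁'0 : 0 ≤ B₁' := (norm_nonneg _).trans (hB₁' 0 0)
  have hsmall : ∀ j, s < j → j ≤ n → ∀ f : Edge j, ‖S.iterBlockSpinLog j n (S.logData A' n) f‖ < S.εF := by
    intro j hj hjn f
    have h1 := Hs A' B₁' hB₁' hcap n j (lt_trans (lt_of_le_of_lt (le_max_left _ _) hs) hj) hjn f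
    have hℓ : latLen j < S.εF / (K₁ * B₁ + 1) :=
      (latLen_lt_of_lt hj).trans (Hε s ((le_max_right _ _).trans hs.le))
    rw [lt_div_iff₀ (by positivity)] at hℓ
    have h2 : K₁ * B₁' * latLen j ≤ (K₁ * B₁ + 1) * latLen j := by
      apply mul_le_mul_of_nonneg_right _ (latLen_pos j).le
      nlinarith [mul_le_mul_of_nonneg_left hcap hK₁0]
    linarith
  have h := S.iterBlockSpin_exp s n hsn (S.logData A' n) hsmall
  have hg0 : (fun f : Edge n => S.g0 A' f) = fun f => S.exp (S.logData A' n f) := rfl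
  show S.iterBlockSpin s n (fun f => S.g0 A' f) e = _
  rw [hg0, h]

/-! ## §3 The per-plaquette expansion at finite run length, for a globally bounded potential -/

/-- **Per-plaquette expansion of the approximates (11)** for Federbush's scheme under injectivity of `exp` on a ball and the
second-order BCH estimate: given caps `B₁, B₂` there are `K ≥ 0` and a level `s₀` such that for every `C¹` potential with
`|A′| ≤ B₁′ ≤ B₁`, `|DA′| ≤ B₂′ ≤ B₂`, all `s₀ < s ≤ n` and every plaquette `p` of `ℒ^s`,
`| |g_∂p(g(·, n)(s))| − |∮_∂p A′ + ℓ_s²[A′_μ(x_p), A′_ν(x_p)]| | ≤ K(B₁′ + B₂′)²ℓ_s³ + 792B₂′ℓ_sℓ_n`.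
[cite: Federbush1987PhaseCellVI, (10)–(11) p. 20, (24) p. 22, (31) p. 23, Theorem 2 p. 20; Federbush1986PhaseCellI, (1.5)
p. 322, (1.13) p. 324] -/
theorem absG_plaqHol_gApprox_expansion (hFS : S.IsFederbushSystem) (hinj : ∃ ρ > (0 : ℝ), InjOn S.exp (ball 0 ρ))
    (hBCH : ∃ ρ > (0 : ℝ), ∃ C : ℝ, ∀ X Y : S.𝔤, ‖X‖ < ρ → ‖Y‖ < ρ →
      dist (S.exp X * S.exp Y) (S.exp (X + Y + (1 / 2 : ℝ) • S.lie X Y)) ≤ C * (‖X‖ + ‖Y‖) ^ 3)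
    (B₁ B₂ : ℝ) (hB₁ : 0 ≤ B₁) (hB₂ : 0 ≤ B₂) :
    ∃ K : ℝ, 0 ≤ K ∧ ∃ s₀ : ℕ, ∀ (A' : S.Potential), ContDiff ℝ 1 A' →
      ∀ (B₁' B₂' : ℝ), (∀ x μ, ‖A' x μ‖ ≤ B₁') → (∀ x μ ν, ‖fderiv ℝ (fun y => A' y μ) x (unitVec ν)‖ ≤ B₂') →
        B₁' ≤ B₁ → B₂' ≤ B₂ → ∀ (n s : ℕ), s₀ < s → s ≤ n → ∀ p : Plaq s,
          |absG (S.plaqHol (S.gApprox A' n s) p) -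
              ‖plaqFunctionalV s A' p + latLen s ^ 2 • S.lie (A' p.src p.dir₁) (A' p.src p.dir₂)‖| ≤
            K * (B₁' + B₂') ^ 2 * latLen s ^ 3 + 792 * B₂' * latLen s * latLen n := by
  obtain ⟨ρ₁, hρ₁, Kb, hKb, L, hL, HBCH⟩ := S.absG_plaqWord_expansion_affine hFS hBCH
  obtain ⟨Kc, hKc, s_c, Hc⟩ := S.norm_plaqV_iterBlockSpinLog_sub_linear_le hFS hinj B₁ B₂ hB₁ hB₂
  obtain ⟨Ke, hKe, He⟩ := S.norm_iterBlockSpinLog_logData_sub_smul_le_of_le hFS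
  obtain ⟨s_e, He'⟩ := He B₁ B₂ hB₁ hB₂
  obtain ⟨s₄, Hrep⟩ := S.gApprox_eq_exp_of_le hFS B₁ hB₁
  -- caps for the auxiliary constants (kept opaque)
  obtain ⟨Xc, hXcdef⟩ : ∃ Xc : ℝ, Xc = B₁ + B₂ := ⟨_, rfl⟩
  have hXc0 : 0 ≤ Xc := by rw [hXcdef]; positivity
  obtain ⟨κD, hκDdef⟩ : ∃ κD : ℝ, κD = Ke * (1 + Xc) + 2 := ⟨_, rfl⟩
  have hκD0 : 0 ≤ κD := by rw [hκDdef]; positivity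
  obtain ⟨Dc, hDcdef⟩ : ∃ Dc : ℝ, Dc = κD * Xc := ⟨_, rfl⟩
  have hDc0 : 0 ≤ Dc := by rw [hDcdef]; positivity
  obtain ⟨sρ, Hρ⟩ := exists_latLen_lt (show 0 < ρ₁ / (4 * (B₁ + Dc) + 1) by positivity)
  refine ⟨64 * Kb * (1 + κD) ^ 3 * Xc + L * (6 * κD + 3 * κD ^ 2) + Kc, by positivity,
    max (max s_c s_e) (max s₄ sρ), ?_⟩
  intro A' hA' B₁' B₂' hB₁' hB₂' h₁ h₂ n s hs hsn p
  have hB₁'0 : 0 ≤ B₁' := (norm_nonneg _).trans (hB₁' 0 0)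
  have hB₂'0 : 0 ≤ B₂' := (norm_nonneg _).trans (hB₂' 0 0 0)
  have hs_c : s_c < s := lt_of_le_of_lt ((le_max_left _ _).trans (le_max_left _ _)) hs
  have hs_e : s_e < s := lt_of_le_of_lt ((le_max_right _ _).trans (le_max_left _ _)) hs
  have hs₄ : s₄ < s := lt_of_le_of_lt ((le_max_left _ _).trans (le_max_right _ _)) hs
  have hsρ : latLen s < ρ₁ / (4 * (B₁ + Dc) + 1) := Hρ s (((le_max_right _ _).trans (le_max_right _ _)).trans hs.le)
  have hℓ := latLen_pos s
  have hℓ1 : latLen s ≤ 1 := latLen_le_one s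
  -- names
  set ℓ : ℝ := latLen s with hℓdef
  set Y : Edge s → S.𝔤 := S.iterBlockSpinLog s n (S.logData A' n) with hYdef
  set U : S.𝔤 := A' p.src p.dir₁ with hUdef
  set W : S.𝔤 := A' p.src p.dir₂ with hWdef
  set e₁ : Edge s := ⟨p.base, p.dir₁⟩ with he₁
  set e₂ : Edge s := ⟨p.base + Pi.single p.dir₁ 1, p.dir₂⟩ with he₂
  set e₃ : Edge s := ⟨p.base + Pi.single p.dir₂ 1, p.dir₁⟩ with he₃
  set e₄ : Edge s := ⟨p.base, p.dir₂⟩ with he₄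
  set δ₁ : S.𝔤 := Y e₁ - ℓ • U with hδ₁def
  set δ₂ : S.𝔤 := Y e₂ - ℓ • W with hδ₂def
  set δ₃ : S.𝔤 := Y e₃ - ℓ • U with hδ₃def
  set δ₄ : S.𝔤 := Y e₄ - ℓ • W with hδ₄def
  obtain ⟨D, hDdef⟩ : ∃ D : ℝ, D = Ke * (B₂' + B₁' ^ 2) + 2 * B₂' := ⟨_, rfl⟩
  have hD0 : 0 ≤ D := by rw [hDdef]; positivity
  have hKeD : Ke * (B₂' + B₁' ^ 2) ≤ D := by rw [hDdef]; linarith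
  -- sources of the four edges
  have hsrc₁ : e₁.src = p.src := rfl
  have hsrc₄ : e₄.src = p.src := rfl
  have hsrc₂ : e₂.src = p.src + ℓ • unitVec p.dir₁ := by
    rw [he₂, src_add_single₇ p.base p.dir₁ p.dir₂ p.dir₁]; rfl
  have hsrc₃ : e₃.src = p.src + ℓ • unitVec p.dir₂ := by
    rw [he₃, src_add_single₇ p.base p.dir₂ p.dir₁ p.dir₁]; rfl
  have hu : ∀ i : Fin 4, ‖unitVec i‖ = 1 := fun i => by simp [unitVec]
  -- the edge variables against ℓ·A′(x_e)
  have hedge : ∀ e : Edge s, ‖Y e - ℓ • A' e.src e.dir‖ ≤ Ke * (B₂' + B₁' ^ 2) * ℓ ^ 2 := fun e =>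
    He' A' hA' B₁' B₂' hB₁' hB₂' h₁ h₂ n s hs_e hsn e
  have hshift : ∀ (i μ : Fin 4), ‖ℓ • A' (p.src + ℓ • unitVec i) μ - ℓ • A' p.src μ‖ ≤ 2 * B₂' * ℓ ^ 2 := by
    intro i μ
    rw [← smul_sub, norm_smul, Real.norm_of_nonneg hℓ.le]
    calc ℓ * ‖A' (p.src + ℓ • unitVec i) μ - A' p.src μ‖ ≤ ℓ * (2 * B₂' * ‖p.src + ℓ • unitVec i - p.src‖) :=
          mul_le_mul_of_nonneg_left (S.norm_sub_le_of_fderiv_le A' hA' hB₂' μ p.src _) hℓ.le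
      _ = 2 * B₂' * ℓ ^ 2 := by rw [add_sub_cancel_left, norm_smul, hu, mul_one, Real.norm_of_nonneg hℓ.le]; ring
  have hδ₁ : ‖δ₁‖ ≤ D * ℓ ^ 2 := by
    calc ‖δ₁‖ = ‖Y e₁ - ℓ • A' e₁.src e₁.dir‖ := by rw [hδ₁def, hsrc₁]
      _ ≤ Ke * (B₂' + B₁' ^ 2) * ℓ ^ 2 := hedge e₁
      _ ≤ D * ℓ ^ 2 := mul_le_mul_of_nonneg_right hKeD (sq_nonneg _)
  have hδ₄ : ‖δ₄‖ ≤ D * ℓ ^ 2 := by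
    calc ‖δ₄‖ = ‖Y e₄ - ℓ • A' e₄.src e₄.dir‖ := by rw [hδ₄def, hsrc₄]
      _ ≤ Ke * (B₂' + B₁' ^ 2) * ℓ ^ 2 := hedge e₄
      _ ≤ D * ℓ ^ 2 := mul_le_mul_of_nonneg_right hKeD (sq_nonneg _)
  have hδ₂ : ‖δ₂‖ ≤ D * ℓ ^ 2 := by
    have h1 : δ₂ = (Y e₂ - ℓ • A' e₂.src e₂.dir) + (ℓ • A' (p.src + ℓ • unitVec p.dir₁) p.dir₂ - ℓ • A' p.src p.dir₂) := by
      rw [hδ₂def, hsrc₂]; abel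
    rw [h1]
    calc _ ≤ ‖Y e₂ - ℓ • A' e₂.src e₂.dir‖ + ‖ℓ • A' (p.src + ℓ • unitVec p.dir₁) p.dir₂ - ℓ • A' p.src p.dir₂‖ :=
          norm_add_le _ _
      _ ≤ Ke * (B₂' + B₁' ^ 2) * ℓ ^ 2 + 2 * B₂' * ℓ ^ 2 := add_le_add (hedge e₂) (hshift _ _)
      _ = D * ℓ ^ 2 := by rw [hDdef]; ring
  have hδ₃ : ‖δ₃‖ ≤ D * ℓ ^ 2 := by
    have h1 : δ₃ = (Y e₃ - ℓ • A' e₃.src e₃.dir) + (ℓ • A' (p.src + ℓ • unitVec p.dir₂) p.dir₁ - ℓ • A' p.src p.dir₁) := by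
      rw [hδ₃def, hsrc₃]; abel
    rw [h1]
    calc _ ≤ ‖Y e₃ - ℓ • A' e₃.src e₃.dir‖ + ‖ℓ • A' (p.src + ℓ • unitVec p.dir₂) p.dir₁ - ℓ • A' p.src p.dir₁‖ :=
          norm_add_le _ _
      _ ≤ Ke * (B₂' + B₁' ^ 2) * ℓ ^ 2 + 2 * B₂' * ℓ ^ 2 := add_le_add (hedge e₃) (hshift _ _)
      _ = D * ℓ ^ 2 := by rw [hDdef]; ring
  -- the polynomial bookkeeping: X = B₁′ + B₂′ (opaque)
  obtain ⟨X, hXdef⟩ : ∃ X : ℝ, X = B₁' + B₂' := ⟨_, rfl⟩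
  have hX0 : 0 ≤ X := by rw [hXdef]; positivity
  have hXle : X ≤ Xc := by rw [hXdef, hXcdef]; linarith
  have hB₁'X : B₁' ≤ X := by rw [hXdef]; linarith
  have hB₂'X : B₂' ≤ X := by rw [hXdef]; linarith
  have hDX : D ≤ κD * X := by
    have h1 : B₁' ^ 2 ≤ X * Xc := by
      rw [sq]; exact mul_le_mul hB₁'X (h₁.trans (by rw [hXcdef]; linarith)) hB₁'0 hX0
    have h3 : Ke * (B₂' + B₁' ^ 2) ≤ Ke * (X + X * Xc) := mul_le_mul_of_nonneg_left (add_le_add hB₂'X h1) hKe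
    have h4 : Ke * (X + X * Xc) + 2 * X = (Ke * (1 + Xc) + 2) * X := by ring
    rw [hDdef, hκDdef, ← h4]
    linarith
  have hDle : D ≤ Dc := hDX.trans (by rw [hDcdef]; exact mul_le_mul_of_nonneg_left hXle hκD0)
  have hBD : B₁' + D ≤ (1 + κD) * X := by
    have : (1 + κD) * X = X + κD * X := by ring
    rw [this]; exact add_le_add hB₁'X hDX
  have hsmall : 4 * (ℓ * (B₁' + D)) < ρ₁ := by
    have h1 : ℓ * (4 * (B₁ + Dc) + 1) < ρ₁ := by rwa [lt_div_iff₀ (by positivity)] at hsρ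
    have h2 : 4 * (ℓ * (B₁' + D)) ≤ ℓ * (4 * (B₁ + Dc)) := by
      rw [show 4 * (ℓ * (B₁' + D)) = ℓ * (4 * (B₁' + D)) by ring]
      exact mul_le_mul_of_nonneg_left (by linarith) hℓ.le
    have h3 : ℓ * (4 * (B₁ + Dc)) ≤ ℓ * (4 * (B₁ + Dc) + 1) := mul_le_mul_of_nonneg_left (by linarith) hℓ.le
    linarith
  -- BCH
  have hU : ‖U‖ ≤ B₁' := by rw [hUdef]; exact hB₁' _ _
  have hW : ‖W‖ ≤ B₁' := by rw [hWdef]; exact hB₁' _ _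
  have hbch := HBCH ℓ B₁' D U W δ₁ δ₂ δ₃ δ₄ hℓ.le hℓ1 hB₁'0 hD0 hsmall hU hW hδ₁ hδ₂ hδ₃ hδ₄
  have hY₁ : ℓ • U + δ₁ = Y e₁ := by rw [hδ₁def]; abel
  have hY₂ : ℓ • W + δ₂ = Y e₂ := by rw [hδ₂def]; abel
  have hY₃ : ℓ • U + δ₃ = Y e₃ := by rw [hδ₃def]; abel
  have hY₄ : ℓ • W + δ₄ = Y e₄ := by rw [hδ₄def]; abel
  rw [hY₁, hY₂, hY₃, hY₄] at hbch
  -- the approximates in log coordinates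
  have hrep : ∀ e : Edge s, S.gApprox A' n s e = S.exp (Y e) := Hrep A' B₁' hB₁' h₁ n s hs₄ hsn
  have hhol : S.plaqHol (S.gApprox A' n s) p = S.exp (Y e₁) * S.exp (Y e₂) * (S.exp (Y e₃))⁻¹ * (S.exp (Y e₄))⁻¹ := by
    rw [show S.plaqHol (S.gApprox A' n s) p =
      S.gApprox A' n s e₁ * S.gApprox A' n s e₂ * (S.gApprox A' n s e₃)⁻¹ * (S.gApprox A' n s e₄)⁻¹ from rfl,
      hrep e₁, hrep e₂, hrep e₃, hrep e₄]
  have hlin : Y e₁ + Y e₂ - Y e₃ - Y e₄ = AxialTreeV.plaqV (AxialTreeV.toCfg Y) p := rfl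
  -- the plaquette value of the log cascade against ∮A′
  have hheart := Hc A' hA' B₁' B₂' hB₁' hB₂' h₁ h₂ n s hs_c hsn p
  have hlinr := S.norm_plaq_linearCascade_logData_sub_le A' hA' hB₂' hsn p
  have hPV : ‖AxialTreeV.plaqV (AxialTreeV.toCfg Y) p - plaqFunctionalV s A' p‖ ≤
      Kc * B₁' * B₂' * ℓ ^ 3 + 792 * B₂' * ℓ * latLen n :=
    (norm_sub_le_norm_sub_add_norm_sub _ _ _).trans (add_le_add hheart hlinr)
  -- constants
  have hE : (64 * Kb * (B₁' + D) ^ 3 + L * (6 * B₁' * D + 3 * D ^ 2)) + Kc * B₁' * B₂' ≤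
      (64 * Kb * (1 + κD) ^ 3 * Xc + L * (6 * κD + 3 * κD ^ 2) + Kc) * X ^ 2 := by
    have hBD0 : 0 ≤ B₁' + D := by positivity
    have h3 : (B₁' + D) ^ 3 ≤ (1 + κD) ^ 3 * Xc * X ^ 2 := by
      calc (B₁' + D) ^ 3 ≤ ((1 + κD) * X) ^ 3 := pow_le_pow_left₀ hBD0 hBD 3
        _ = (1 + κD) ^ 3 * X * X ^ 2 := by ring
        _ ≤ (1 + κD) ^ 3 * Xc * X ^ 2 := by
            apply mul_le_mul_of_nonneg_right _ (sq_nonneg _)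
            exact mul_le_mul_of_nonneg_left hXle (by positivity)
    have h4 : B₁' * D ≤ κD * X ^ 2 := by
      calc B₁' * D ≤ X * (κD * X) := mul_le_mul hB₁'X hDX hD0 hX0
        _ = κD * X ^ 2 := by ring
    have h5 : D ^ 2 ≤ κD ^ 2 * X ^ 2 := by
      rw [← mul_pow]; exact pow_le_pow_left₀ hD0 hDX 2
    have h6 : B₁' * B₂' ≤ X ^ 2 := by
      rw [sq]; exact mul_le_mul hB₁'X (by rw [hXdef]; linarith) hB₂'0 hX0
    have i3 := mul_le_mul_of_nonneg_left h3 (by positivity : (0 : ℝ) ≤ 64 * Kb)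
    have i4 := mul_le_mul_of_nonneg_left h4 (by positivity : (0 : ℝ) ≤ 6 * L)
    have i5 := mul_le_mul_of_nonneg_left h5 (by positivity : (0 : ℝ) ≤ 3 * L)
    have i6 := mul_le_mul_of_nonneg_left h6 hKc
    have hexp : (64 * Kb * (B₁' + D) ^ 3 + L * (6 * B₁' * D + 3 * D ^ 2)) + Kc * B₁' * B₂' =
        64 * Kb * (B₁' + D) ^ 3 + 6 * L * (B₁' * D) + 3 * L * D ^ 2 + Kc * (B₁' * B₂') := by ring
    have hexp' : (64 * Kb * (1 + κD) ^ 3 * Xc + L * (6 * κD + 3 * κD ^ 2) + Kc) * X ^ 2 =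
        64 * Kb * ((1 + κD) ^ 3 * Xc * X ^ 2) + 6 * L * (κD * X ^ 2) + 3 * L * (κD ^ 2 * X ^ 2) + Kc * X ^ 2 := by ring
    rw [hexp, hexp']
    linarith
  -- assembling
  have hℓ3 : 0 ≤ ℓ ^ 3 := by positivity
  rw [hhol]
  set M : S.𝔤 := plaqFunctionalV s A' p + ℓ ^ 2 • S.lie U W with hMdef
  set V : S.𝔤 := Y e₁ + Y e₂ - Y e₃ - Y e₄ + ℓ ^ 2 • S.lie U W with hVdef
  have hVM : V - M = AxialTreeV.plaqV (AxialTreeV.toCfg Y) p - plaqFunctionalV s A' p := by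
    rw [hVdef, hMdef, hlin]; abel
  calc |absG (S.exp (Y e₁) * S.exp (Y e₂) * (S.exp (Y e₃))⁻¹ * (S.exp (Y e₄))⁻¹) - ‖M‖|
      ≤ |absG (S.exp (Y e₁) * S.exp (Y e₂) * (S.exp (Y e₃))⁻¹ * (S.exp (Y e₄))⁻¹) - ‖V‖| + |‖V‖ - ‖M‖| :=
        abs_sub_le _ _ _
    _ ≤ (64 * Kb * (B₁' + D) ^ 3 + L * (6 * B₁' * D + 3 * D ^ 2)) * ℓ ^ 3 +
          (Kc * B₁' * B₂' * ℓ ^ 3 + 792 * B₂' * ℓ * latLen n) := by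
        refine add_le_add hbch ((abs_norm_sub_norm_le V M).trans ?_)
        rw [hVM]; exact hPV
    _ = ((64 * Kb * (B₁' + D) ^ 3 + L * (6 * B₁' * D + 3 * D ^ 2)) + Kc * B₁' * B₂') * ℓ ^ 3 +
          792 * B₂' * ℓ * latLen n := by ring
    _ ≤ (64 * Kb * (1 + κD) ^ 3 * Xc + L * (6 * κD + 3 * κD ^ 2) + Kc) * X ^ 2 * ℓ ^ 3 +
          792 * B₂' * ℓ * latLen n :=
        add_le_add (mul_le_mul_of_nonneg_right hE hℓ3) le_rfl
    _ = (64 * Kb * (1 + κD) ^ 3 * Xc + L * (6 * κD + 3 * κD ^ 2) + Kc) * (B₁' + B₂') ^ 2 * ℓ ^ 3 +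
          792 * B₂' * ℓ * latLen n := by rw [hXdef]

/-! ## §4 The associated family: localisation by cutoffs and the limit (12) -/

/-- Injectivity of `exp` on a ball, from the bi-Lipschitz chart (T-F6-1). [cite: Federbush1987PhaseCellVI, (13) p. 21] -/
theorem injOn_exp_of_chart
    (hchart : ∃ ρ > (0 : ℝ), ∃ C ≥ (1 : ℝ),
      (∀ X Y : S.𝔤, ‖X‖ < ρ → ‖Y‖ < ρ →
        C⁻¹ * ‖X - Y‖ ≤ dist (S.exp X) (S.exp Y) ∧ dist (S.exp X) (S.exp Y) ≤ C * ‖X - Y‖) ∧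
      ∀ g : S.G, absG g < ρ / C → ∃ X : S.𝔤, ‖X‖ < ρ ∧ S.exp X = g) :
    ∃ ρ > (0 : ℝ), InjOn S.exp (ball 0 ρ) := by
  obtain ⟨ρ, hρ, C, hC, hlip, -⟩ := hchart
  refine ⟨ρ, hρ, fun X hX Y hY hXY => ?_⟩
  rw [mem_ball_zero_iff] at hX hY
  have h := (hlip X Y hX hY).1
  rw [hXY, dist_self] at h
  have hC0 : 0 < C⁻¹ := inv_pos.2 (lt_of_lt_of_le one_pos hC)
  have : ‖X - Y‖ ≤ 0 := by nlinarith [norm_nonneg (X - Y)]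
  exact sub_eq_zero.1 (norm_le_zero_iff.1 this)

/-- The plaquette functional `∮_∂p A` (averaged, I (1.13)) depends on the potential only within `8ℓ_s ≤ 8` of `x_p`.
[cite: Federbush1986PhaseCellI, (1.13) p. 324; Federbush1987PhaseCellVI, (10) p. 20] -/
theorem plaqFunctionalV_congr_of_eqOn {A A' : S.Potential} {s : ℕ} (p : Plaq s)
    (h : ∀ y ∈ closedBall p.src 9, A' y = A y) : plaqFunctionalV s A' p = plaqFunctionalV s A p := by
  have hℓ := latLen_pos s
  have hℓ1 := latLen_le_one s
  have hu : ∀ i : Fin 4, ‖unitVec i‖ = 1 := fun i => by simp [unitVec]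
  unfold plaqFunctionalV
  refine setIntegral_congr_fun measurableSet_Icc fun u hu' => ?_
  have hmk : ‖latLen s • mkPt u‖ ≤ 6 * latLen s := by
    rw [norm_smul, Real.norm_of_nonneg hℓ.le, mul_comm]
    refine mul_le_mul_of_nonneg_right (norm_mkPt_le_of_abs_le u fun k => ?_) hℓ.le
    have h0k : (0 : ℝ) ≤ u k := by simpa using hu'.1 k
    have h1k : u k ≤ 1 := by simpa using hu'.2 k
    rw [abs_le]; exact ⟨by linarith, by linarith⟩
  -- every point of the four edge segments is within 8ℓ ≤ 9 of x_p
  have hseg : ∀ (v : E4), ‖v‖ ≤ 2 * latLen s → ∀ t ∈ Set.uIcc (0 : ℝ) (latLen s), ∀ i : Fin 4,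
      p.src + latLen s • mkPt u + v + t • unitVec i ∈ closedBall p.src 9 := by
    intro v hv t ht i
    rw [mem_closedBall, dist_eq_norm]
    have ht' : |t| ≤ latLen s := by
      rw [Set.uIcc_of_le hℓ.le] at ht; rw [abs_of_nonneg ht.1]; exact ht.2
    calc ‖p.src + latLen s • mkPt u + v + t • unitVec i - p.src‖ = ‖latLen s • mkPt u + v + t • unitVec i‖ := by
          congr 1; abel
      _ ≤ ‖latLen s • mkPt u‖ + ‖v‖ + ‖t • unitVec i‖ := norm_add₃_le
      _ ≤ 6 * latLen s + 2 * latLen s + latLen s := by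
          refine add_le_add (add_le_add hmk hv) ?_
          rw [norm_smul, hu, mul_one, Real.norm_eq_abs]; exact ht'
      _ ≤ 9 := by linarith
  have hline : ∀ (v : E4), ‖v‖ ≤ 2 * latLen s → ∀ i : Fin 4,
      lineIntV A' (p.src + latLen s • mkPt u + v) i (latLen s) = lineIntV A (p.src + latLen s • mkPt u + v) i (latLen s) := by
    intro v hv i
    unfold lineIntV
    refine intervalIntegral.integral_congr fun t ht => ?_
    show A' (p.src + latLen s • mkPt u + v + t • unitVec i) i = A (p.src + latLen s • mkPt u + v + t • unitVec i) i
    rw [h _ (hseg v hv t ht i)]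
  have h0 : ‖(0 : E4)‖ ≤ 2 * latLen s := by rw [norm_zero]; positivity
  have hℓv : ∀ i : Fin 4, ‖latLen s • unitVec i‖ ≤ 2 * latLen s := fun i => by
    rw [norm_smul, hu, mul_one, Real.norm_of_nonneg hℓ.le]; linarith
  unfold loopIntV
  have e1 := hline 0 h0 p.dir₁
  have e2 := hline _ (hℓv p.dir₁) p.dir₂
  have e3 := hline _ (hℓv p.dir₂) p.dir₁
  have e4 := hline 0 h0 p.dir₂
  simp only [add_zero] at e1 e4
  rw [e1, e2, e3, e4]

/-- Continuity of the plaquette holonomy in its four edge variables (isometric group metric).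
[cite: Federbush1987PhaseCellVI, (10), (12) p. 20] -/
theorem tendsto_plaqHol {s : ℕ} (u : ℕ → Edge s → S.G) (v : Edge s → S.G) (p : Plaq s)
    (h : ∀ e : Edge s, Tendsto (fun n => u n e) atTop (𝓝 (v e))) :
    Tendsto (fun n => S.plaqHol (u n) p) atTop (𝓝 (S.plaqHol v p)) := by
  haveI := S.continuousMul
  have hinv : ∀ e : Edge s, Tendsto (fun n => (u n e)⁻¹) atTop (𝓝 (v e)⁻¹) := by
    intro e
    rw [tendsto_iff_dist_tendsto_zero] at *
    have := h e
    rw [tendsto_iff_dist_tendsto_zero] at this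
    simpa only [dist_inv_inv] using this
  unfold plaqHol
  exact (((h _).mul (h _)).mul (hinv _)).mul (hinv _)

/-- **Per-plaquette expansion of the associated lattice assignments, with LOCAL bounds** — the heart of Theorem 2: for
Federbush's scheme under the bi-Lipschitz log chart (T-F6-1) and the second-order BCH estimate, a `C¹` potential `A` bounded
with bounded axis derivatives, and the family `g` associated to `A` (Theorem 1), there are `K ≥ 0` and a level `s₀` such that
for every `s > s₀`, every plaquette `p` of `ℒ^s` and all bounds `B₁′, B₂′ ≥ 0` of `|A|`, `|DA|` on `closedBall x_p 10`:
`| |g_∂p(g(s))| − |∮_∂p A + ℓ_s²[A_μ(x_p), A_ν(x_p)]| | ≤ K(B₁′ + B₂′)²ℓ_s³`. [cite: Federbush1987PhaseCellVI, Theorem 2 p. 20,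
(10)–(12) p. 20, p. 23; Federbush1986PhaseCellI, (1.13) p. 324] -/
theorem absG_plaqHol_assoc_expansion (hFS : S.IsFederbushSystem)
    (hchart : ∃ ρ > (0 : ℝ), ∃ C ≥ (1 : ℝ),
      (∀ X Y : S.𝔤, ‖X‖ < ρ → ‖Y‖ < ρ →
        C⁻¹ * ‖X - Y‖ ≤ dist (S.exp X) (S.exp Y) ∧ dist (S.exp X) (S.exp Y) ≤ C * ‖X - Y‖) ∧
      ∀ g : S.G, absG g < ρ / C → ∃ X : S.𝔤, ‖X‖ < ρ ∧ S.exp X = g)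
    (hBCH : ∃ ρ > (0 : ℝ), ∃ C : ℝ, ∀ X Y : S.𝔤, ‖X‖ < ρ → ‖Y‖ < ρ →
      dist (S.exp X * S.exp Y) (S.exp (X + Y + (1 / 2 : ℝ) • S.lie X Y)) ≤ C * (‖X‖ + ‖Y‖) ^ 3)
    (A : S.Potential) (hA : ContDiff ℝ 1 A) {B₁ B₂ : ℝ} (hB₁ : ∀ x μ, ‖A x μ‖ ≤ B₁)
    (hB₂ : ∀ x μ ν, ‖fderiv ℝ (fun y => A y μ) x (unitVec ν)‖ ≤ B₂)
    {g : (r : ℕ) → Edge r → S.G} (hg : S.IsAssociated A g) :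
    ∃ K : ℝ, 0 ≤ K ∧ ∃ s₀ : ℕ, ∀ s, s₀ < s → ∀ (p : Plaq s) (B₁' B₂' : ℝ), 0 ≤ B₁' → 0 ≤ B₂' →
      (∀ y ∈ closedBall p.src 10, ∀ μ, ‖A y μ‖ ≤ B₁') →
      (∀ y ∈ closedBall p.src 10, ∀ μ ν, ‖fderiv ℝ (fun z => A z μ) y (unitVec ν)‖ ≤ B₂') →
        |absG (S.plaqHol (g s) p) - ‖plaqFunctionalV s A p + latLen s ^ 2 • S.lie (A p.src p.dir₁) (A p.src p.dir₂)‖| ≤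
          K * (B₁' + B₂') ^ 2 * latLen s ^ 3 := by
  have hB₁0 : 0 ≤ B₁ := (norm_nonneg _).trans (hB₁ 0 0)
  have hB₂0 : 0 ≤ B₂ := (norm_nonneg _).trans (hB₂ 0 0 0)
  obtain ⟨κ, hκ, Hcut⟩ := S.cutoff_bounds_of_local
  obtain ⟨K, hK, s₀, H⟩ := S.absG_plaqHol_gApprox_expansion hFS (S.injOn_exp_of_chart hchart) hBCH B₁ (B₂ + κ * B₁)
    hB₁0 (by positivity)
  obtain ⟨g', -, htend, huniq⟩ := S.theorem1_of_chart_tendsto hchart hFS A hA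
  have hgg : g = g' := huniq g hg
  refine ⟨K * (1 + κ) ^ 2, by positivity, s₀, fun s hs p B₁' B₂' hB₁'0 hB₂'0 hloc₁ hloc₂ => ?_⟩
  have hℓ := latLen_pos s
  have hℓ1 := latLen_le_one s
  -- reduce the local bounds below the global ones
  set m₁ : ℝ := min B₁' B₁ with hm₁
  set m₂ : ℝ := min B₂' B₂ with hm₂
  have hm₁0 : 0 ≤ m₁ := le_min hB₁'0 hB₁0
  have hm₂0 : 0 ≤ m₂ := le_min hB₂'0 hB₂0
  have hloc₁' : ∀ y ∈ closedBall p.src 10, ∀ μ, ‖A y μ‖ ≤ m₁ := fun y hy μ => le_min (hloc₁ y hy μ) (hB₁ y μ)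
  have hloc₂' : ∀ y ∈ closedBall p.src 10, ∀ μ ν, ‖fderiv ℝ (fun z => A z μ) y (unitVec ν)‖ ≤ m₂ :=
    fun y hy μ ν => le_min (hloc₂ y hy μ ν) (hB₂ y μ ν)
  -- the cutoff
  set A' : S.Potential := S.cutoff p.src 9 A with hA'def
  have hA' : ContDiff ℝ 1 A' := S.contDiff_cutoff p.src 9 hA
  obtain ⟨hA'₁, hA'₂⟩ := Hcut p.src A hA m₁ m₂ hm₁0 hm₂0 hloc₁' hloc₂'
  have hcap₁ : m₁ ≤ B₁ := min_le_right _ _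
  have hcap₂ : m₂ + κ * m₁ ≤ B₂ + κ * B₁ :=
    add_le_add (min_le_right _ _) (mul_le_mul_of_nonneg_left hcap₁ hκ)
  have hEq : ∀ y ∈ closedBall p.src 9, A' y = A y := fun y hy => S.cutoff_eq_of_mem A hy
  -- the finite-n expansion for the cutoff
  have hfin : ∀ n, s ≤ n → |absG (S.plaqHol (S.gApprox A' n s) p) -
      ‖plaqFunctionalV s A p + latLen s ^ 2 • S.lie (A p.src p.dir₁) (A p.src p.dir₂)‖| ≤
        K * (m₁ + (m₂ + κ * m₁)) ^ 2 * latLen s ^ 3 + 792 * (m₂ + κ * m₁) * latLen s * latLen n := by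
    intro n hn
    have h := H A' hA' m₁ (m₂ + κ * m₁) hA'₁ hA'₂ hcap₁ hcap₂ n s hs hn p
    have hsrc : A' p.src = A p.src := hEq _ (mem_closedBall_self (by norm_num))
    rwa [S.plaqFunctionalV_congr_of_eqOn p hEq, hsrc] at h
  -- the approximates of the cutoff converge to g at the four edges of p
  have hball : ∀ e : Edge s, dist e.src p.src ≤ latLen s →
      ∀ y ∈ closedBall e.src (6 * latLen s), A y = A' y := by
    intro e he y hy
    refine (hEq y ?_).symm
    rw [mem_closedBall] at hy ⊢
    calc dist y p.src ≤ dist y e.src + dist e.src p.src := dist_triangle _ _ _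
      _ ≤ 6 * latLen s + latLen s := add_le_add hy he
      _ ≤ 9 := by linarith
  have hu : ∀ i : Fin 4, ‖unitVec i‖ = 1 := fun i => by simp [unitVec]
  have hconv : ∀ e : Edge s, dist e.src p.src ≤ latLen s → Tendsto (fun n => S.gApprox A' n s e) atTop (𝓝 (g s e)) := by
    intro e he
    have h1 : (fun n => S.gApprox A' n s e) = fun n => S.gApprox A n s e :=
      funext fun n => (S.gApprox_congr_of_eqOn hFS e (hball e he) n).symm
    rw [h1, hgg]
    exact htend s e
  have hd₁ : dist (⟨p.base, p.dir₁⟩ : Edge s).src p.src ≤ latLen s := by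
    rw [show (⟨p.base, p.dir₁⟩ : Edge s).src = p.src from rfl, dist_self]; exact hℓ.le
  have hd₄ : dist (⟨p.base, p.dir₂⟩ : Edge s).src p.src ≤ latLen s := by
    rw [show (⟨p.base, p.dir₂⟩ : Edge s).src = p.src from rfl, dist_self]; exact hℓ.le
  have hd₂ : dist (⟨p.base + Pi.single p.dir₁ 1, p.dir₂⟩ : Edge s).src p.src ≤ latLen s := by
    rw [src_add_single₇ p.base p.dir₁ p.dir₂ p.dir₁, show (⟨p.base, p.dir₁⟩ : Edge s).src = p.src from rfl,
      dist_eq_norm, add_sub_cancel_left, norm_smul, hu, mul_one, Real.norm_of_nonneg hℓ.le]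
  have hd₃ : dist (⟨p.base + Pi.single p.dir₂ 1, p.dir₁⟩ : Edge s).src p.src ≤ latLen s := by
    rw [src_add_single₇ p.base p.dir₂ p.dir₁ p.dir₁, show (⟨p.base, p.dir₁⟩ : Edge s).src = p.src from rfl,
      dist_eq_norm, add_sub_cancel_left, norm_smul, hu, mul_one, Real.norm_of_nonneg hℓ.le]
  have hhol : Tendsto (fun n => S.plaqHol (S.gApprox A' n s) p) atTop (𝓝 (S.plaqHol (g s) p)) := by
    have key : ∀ e : Edge s, Tendsto (fun n => (if dist e.src p.src ≤ latLen s then S.gApprox A' n s e else g s e))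
        atTop (𝓝 (g s e)) := by
      intro e
      by_cases he : dist e.src p.src ≤ latLen s
      · simp only [he, if_true]; exact hconv e he
      · simp only [he, if_false]; exact tendsto_const_nhds
    have heq : ∀ n, S.plaqHol (S.gApprox A' n s) p =
        S.plaqHol (fun e => if dist e.src p.src ≤ latLen s then S.gApprox A' n s e else g s e) p := by
      intro n
      simp only [plaqHol, hd₁, hd₂, hd₃, hd₄, if_true]
    simp_rw [heq]
    exact S.tendsto_plaqHol _ _ p key
  have habs : Tendsto (fun n => |absG (S.plaqHol (S.gApprox A' n s) p) -
      ‖plaqFunctionalV s A p + latLen s ^ 2 • S.lie (A p.src p.dir₁) (A p.src p.dir₂)‖|) atTop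
      (𝓝 (|absG (S.plaqHol (g s) p) -
        ‖plaqFunctionalV s A p + latLen s ^ 2 • S.lie (A p.src p.dir₁) (A p.src p.dir₂)‖|)) := by
    have hc : Continuous fun x : S.G => |absG x -
        ‖plaqFunctionalV s A p + latLen s ^ 2 • S.lie (A p.src p.dir₁) (A p.src p.dir₂)‖| := by
      unfold absG; fun_prop
    exact (hc.tendsto _).comp hhol
  have hrhs : Tendsto (fun n : ℕ => K * (m₁ + (m₂ + κ * m₁)) ^ 2 * latLen s ^ 3 + 792 * (m₂ + κ * m₁) * latLen s * latLen n)
      atTop (𝓝 (K * (m₁ + (m₂ + κ * m₁)) ^ 2 * latLen s ^ 3 + 792 * (m₂ + κ * m₁) * latLen s * 0)) :=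
    tendsto_const_nhds.add (tendsto_const_nhds.mul tendsto_latLen₇)
  rw [mul_zero, add_zero] at hrhs
  have hlim := le_of_tendsto_of_tendsto habs hrhs (eventually_atTop.2 ⟨s, fun n hn => hfin n hn⟩)
  refine hlim.trans ?_
  have hm₁le : m₁ ≤ B₁' := min_le_left _ _
  have hm₂le : m₂ ≤ B₂' := min_le_left _ _
  have h1 : m₁ + (m₂ + κ * m₁) ≤ (1 + κ) * (B₁' + B₂') := by nlinarith [mul_nonneg hκ hB₂'0]
  have h2 : (m₁ + (m₂ + κ * m₁)) ^ 2 ≤ ((1 + κ) * (B₁' + B₂')) ^ 2 := pow_le_pow_left₀ (by positivity) h1 2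
  calc K * (m₁ + (m₂ + κ * m₁)) ^ 2 * latLen s ^ 3 ≤ K * ((1 + κ) * (B₁' + B₂')) ^ 2 * latLen s ^ 3 := by
        apply mul_le_mul_of_nonneg_right _ (by positivity)
        exact mul_le_mul_of_nonneg_left h2 hK
    _ = K * (1 + κ) ^ 2 * (B₁' + B₂') ^ 2 * latLen s ^ 3 := by ring

end BlockSpinSystem

end

end Literature.MathematicalPhysics.QuantumFieldTheory.Federbush1986
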